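import Summits.QuantumFields.BalabanUV.T4Continuum.Support.NE7HintUnconditionalGeneric
import Summits.QuantumFields.BalabanUV.T4Continuum.Support.NE7PairDecompNL0Generic
import Summits.QuantumFields.BalabanUV.T4Continuum.Support.NE7ConvOneStepGenericSliceTangent
import Summits.QuantumFields.BalabanUV.T4Continuum.Support.NE7OpenOfMinimisation
import HarnessLib

/-!
# NE7AllMinimisersSmallGeneric — PORT MAP P3.1: (8)∀ FOR EVERY UNITARY GAUGE GROUP `U(n)` AND EVERY BLOCK SIZE `L ≥ 2`, `d = 4`: EVERY MINIMISER IS INTERIOR WITH RELATIVE RADIUS `ε∕4`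
# — `NE7AllMinimisersSmallSU2.all_minimisers_small_SU2` (gen 105, `card n = 2`, `L = 2`) RE-ISSUED GENERICALLY: over the small data, for every `0 < ε ≤ ε₀(L, card n)`, every level `k`
# and EVERY constrained minimiser `U` over `sfClass 4 L N ε`, `SmallField U ((ε∕4)∕(L^k)²)`

Cell `pub-balaban`, rung (B)+1 sub-cell t4, lineage `b2b-balaban-t4-ne7-p1`, generation 109 (CRUX PROVER NE7 #1 = OWNER of BINDER row NE7).  Memo
`t4/b2b-balaban-t4-ne7-p1-g109/ROAD-G109.md` §3 (PORT MAP item P3.1).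
THE ARGUMENT (gen 105's, verbatim under the recipe).  `U♯` := the (8)∃ minimiser of the SMALLER class `sfClass 4 L N (ε∕4)` at level `k+1` (P2.6 `hint_small_data_generic` at `ε∕4`): admissible
in the `ε`-class, interior in its own class, hence tangent-critical (`NE7OpenOfMinimisation.tanCritical_of_isMinimiser`, the level family from the class package).  For every admissible `U′`
of the `ε`-class, P3.0a `decomp_of_nl0_pair_generic` gives `u`, `X = X_T + X_N` over the energy block-Landau slice with `U′^{u} = U♯·e^{X}` and the weighted letters with the k-free currencies
`(C_S·ε, ν_c·ε, κ_c·ε)`; the per-level strict line follows from ONE k-free line (gen 105's `line_of_small_card` with `Q = 2(1 + C_E + 1) ≥ 4`, `c = card n`) by `kfree_coercivity_card`.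
Gen 99's generic ALL-SMALL (`NE7ConvOneStepGenericSliceTangent.allSmall_of_tanCritical_rep_generic_gauge`, with `hT_energyBlockLandau` and the class package's slice-Poincaré clause)
then says: every admissible `U′` with action `≤` that of `U♯` is `SmallField ((ε∕4)∕M²)`.  Level `0`: the only admissible configuration is the datum.
WHAT ([folklore]; 0 def, 0 sorry).  `admissible_mono_radius`, `eq_of_admissible_zero` (any `L`), **`all_minimisers_small_generic`**: for every `L ≥ 2`: `∃ ε₀ > 0, ∀ 0 < ε ≤ ε₀, ∀ N ≥ 1,
∃ δ_V > 0, ∀ V (unitary, N-periodic, SmallField V δ_V), ∀ k U, IsMinimiser 4 (sfClass 4 L N ε) L N k V U → SmallField U ((ε∕4)∕(L^k)²)` — [Balaban1985Variational] Thm 1 (8)-for-all TYPE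
for OUR constrained Wilson minimisers, every `U(n)`, every `L ≥ 2`.
HONEST FRAMING (page 1): composition of landed kernel theorems of this lineage (gens 90–109) and [B7]∕[B8]∕[B11] AS TYPED; nothing of Bałaban's asserted as an axiom; finite 4-torus, small data,
constants existential; NOT NE7, NOT NE3; spine count = dagwriter∕referees' call; NOT infinite volume, NOT mass gap, NOT BetaPertH, NOT Clay (continuum YM on T⁴ ⇐ BetaPertH ∧ nine spine
estimates).
-/

set_option autoImplicit false

open scoped BigOperators Matrix Matrix.Norms.L2Operator
open NormedSpace Finset Set

namespace Summit.QuantumFields.BalabanUV.T4Continuum.NE7AllMinimisersSmallGeneric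

open Literature.MathematicalPhysics.QuantumFieldTheory.Balaban1983to89
open B7Prop1Explicit B7Prop2Explicit
open T4AveragingDeficitWall (IsUnitaryCfg IsSkewDir SmallField vary curl curlSq dirSq)
open T4AveragingDeficitWallBoundary (IsPeriodicCfg periodBox)
open AveragingDeficitPeriodicCounting (IsPeriodicDir)
open AveragingDeficitMultiLevelPrep (LevelSmall TangentIter)
open MinimalActionLevels (perWin levelAction)
open MinimalActionSandwich (IsMinimiser admissible)
open MinimalActionRate (sfClass)
open NE3HessForm (dAction)
open NE3SlicePoincareShape (slicePoincare_mono)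
open NE3EnergyShapes (IsUnitarySite IsPeriodicSite)
open NE3EnergyWeightedShapes (energyNormW)
open NE7MeanZeroGaugeSliceW (energyBlockLandauW)
open NE7ConvOneStepGenericSlice (hT_energyBlockLandau)
open NE7ConvOneStepGenericSliceTangent (allSmall_of_tanCritical_rep_generic_gauge)
open NE7OpenOfMinimisation (tanCritical_of_isMinimiser)
open NE7HintUnconditionalGeneric (hint_small_data_generic)
open NE7PairDecompNL0Generic (decomp_of_nl0_pair_generic)
open NE7EnergyRateWGeneric (line_of_small_card kfree_coercivity_card)
open NE7EnergyClassPoincareGeneric (classPackage)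

noncomputable section

variable {n : Type} [Fintype n] [DecidableEq n]

/-- Admissibility is monotone in the class radius (any block size). [folklore] -/
theorem admissible_mono_radius {L N k : ℕ} {ε ε' : ℝ} (hle : ε' ≤ ε) {V U : Site 4 → Fin 4 → (Matrix n n ℂ)ˣ}
    (hU : U ∈ admissible (sfClass 4 L N ε') L k V) : U ∈ admissible (sfClass 4 L N ε) L k V := by
  obtain ⟨⟨hu, hP, hS⟩, havg⟩ := hU
  exact ⟨⟨hu, hP, MinimalActionRate.SmallField.mono hS (div_le_div_of_nonneg_right hle (by positivity))⟩, havg⟩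

/-- At level `0` the only admissible configuration over the datum `V` is `V` itself (any block size). [folklore] -/
theorem eq_of_admissible_zero {L N : ℕ} {ε : ℝ} {V U : Site 4 → Fin 4 → (Matrix n n ℂ)ˣ} (hU : U ∈ admissible (sfClass 4 L N ε) L 0 V) : U = V := hU.2

set_option maxHeartbeats 800000 in
/-- **(8)∀ FOR EVERY `U(n)` AND EVERY `L ≥ 2`, `d = 4`: EVERY MINIMISER IS INTERIOR WITH RELATIVE RADIUS `ε∕4`** (statement and argument in the file header). [folklore] -/
theorem all_minimisers_small_generic [Nonempty n] {L : ℕ} (hL : 2 ≤ L) :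
    ∃ ε₀ : ℝ, 0 < ε₀ ∧ ∀ ε : ℝ, 0 < ε → ε ≤ ε₀ → ∀ (N : ℕ) [NeZero N], 1 ≤ N →
      ∃ δV : ℝ, 0 < δV ∧
        ∀ V ∈ {V : Site 4 → Fin 4 → (Matrix n n ℂ)ˣ | IsUnitaryCfg V ∧ IsPeriodicCfg V (N : ℤ) ∧ SmallField V δV},
        ∀ (k : ℕ) (U : Site 4 → Fin 4 → (Matrix n n ℂ)ˣ), IsMinimiser 4 (sfClass 4 L N ε) L N k V U →
          SmallField U ((ε / 4) / ((L : ℝ) ^ k) ^ 2) := by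
  haveI : NeZero L := ⟨by omega⟩
  have hL1 : 1 ≤ L := by omega
  have hL0 : (0 : ℝ) < L := by exact_mod_cast (show 0 < L by omega)
  obtain ⟨ε₁, hε₁, H⟩ := hint_small_data_generic (n := n) hL
  obtain ⟨ε₂, hε₂, CS, hCS, νc, hνc, κc, hκc, hdec⟩ := decomp_of_nl0_pair_generic (n := n) hL
  obtain ⟨θ₀, CF, CE, hθ₀, -, -, hCE, -, -, hls, -, hPE⟩ := classPackage (n := n) (d := 4) (by norm_num) hL
  -- the k-free line with the Poincaré constant `C_E + 1`
  obtain ⟨CP, hCP⟩ : ∃ CP : ℝ, CP = CE + 1 := ⟨_, rfl⟩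
  have hCP1 : 1 ≤ CP := by rw [hCP]; linarith
  have hCP0 : 0 ≤ CP := by linarith
  have hCP0' : 0 < CP := by linarith
  obtain ⟨Q, hQ⟩ : ∃ Q : ℝ, Q = 2 * (1 + CP) := ⟨_, rfl⟩
  have hQ4 : 4 ≤ Q := by rw [hQ]; linarith
  obtain ⟨cL, hcL⟩ : ∃ cL : ℝ, cL = 2 * κc + νc ^ 2 + 2304 * (CS ^ 2 * Real.exp (2 * CS)) + 112 * (1 + 7 * CS ^ 2) + 1 := ⟨_, rfl⟩
  have hcL0 : 0 < cL := by rw [hcL]; positivity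
  have hQ0 : 0 < Q := by linarith
  have hcard1 : (1 : ℝ) ≤ (Fintype.card n : ℝ) := by exact_mod_cast Fintype.card_pos
  have hcard0 : (0 : ℝ) < (Fintype.card n : ℝ) := by linarith
  obtain ⟨ε₃, hε₃⟩ : ∃ ε₃ : ℝ, ε₃ = (1 / 2) / Q / 4 / (Fintype.card n : ℝ) / cL := ⟨_, rfl⟩
  have hε₃0 : 0 < ε₃ := by rw [hε₃]; positivity
  have hcard : (0 : ℝ) < 1000000000000000000000 * (L : ℝ) ^ 6 * (Fintype.card n : ℝ) := by positivity
  refine ⟨min ε₁ (min ε₂ (min θ₀ (min (1 / (1000000000000000000000 * (L : ℝ) ^ 6 * (Fintype.card n : ℝ))) (min ε₃ 1)))),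
    lt_min hε₁ (lt_min hε₂ (lt_min hθ₀ (lt_min (by positivity) (lt_min hε₃0 one_pos)))), ?_⟩
  intro ε hε hεle N _ hN
  have hεε₁ : ε ≤ ε₁ := hεle.trans (min_le_left _ _)
  have hεε₂ : ε ≤ ε₂ := hεle.trans ((min_le_right _ _).trans (min_le_left _ _))
  have hεθ₀ : ε ≤ θ₀ := hεle.trans ((min_le_right _ _).trans ((min_le_right _ _).trans (min_le_left _ _)))
  have hεθ : ε ≤ 1 / (1000000000000000000000 * (L : ℝ) ^ 6 * (Fintype.card n : ℝ)) :=
    hεle.trans ((min_le_right _ _).trans ((min_le_right _ _).trans ((min_le_right _ _).trans (min_le_left _ _))))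
  have hεε₃ : ε ≤ ε₃ := hεle.trans ((min_le_right _ _).trans ((min_le_right _ _).trans ((min_le_right _ _).trans ((min_le_right _ _).trans (min_le_left _ _)))))
  have hε1 : ε ≤ 1 := hεle.trans ((min_le_right _ _).trans ((min_le_right _ _).trans ((min_le_right _ _).trans ((min_le_right _ _).trans (min_le_right _ _)))))
  have hε4 : 0 < ε / 4 := by positivity
  have hε4θ : ε / 4 ≤ θ₀ := by linarith
  have hθline : 1000000000000000000000 * (L : ℝ) ^ 6 * (Fintype.card n : ℝ) * ε ≤ 1 := by
    rw [le_div_iff₀ hcard] at hεθ; linarith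
  have hsmall : cL * ε ≤ (1 / 2) / Q / 4 / (Fintype.card n : ℝ) := by
    have h1 : cL * ε ≤ cL * ε₃ := mul_le_mul_of_nonneg_left hεε₃ hcL0.le
    have h2 : cL * ε₃ = (1 / 2) / Q / 4 / (Fintype.card n : ℝ) := by rw [hε₃]; field_simp
    linarith only [h1, h2]
  have hline := line_of_small_card (c := (Fintype.card n : ℝ)) hQ4 hcard1 hCS hε hε1 (by rw [← hcL]; exact hsmall)
  -- the level family at the two radii
  have hlsε : ∀ j : ℕ, LevelSmall 4 L j (ε / ((L : ℝ) ^ (j + 1)) ^ 2) := hls hε.le hεθ₀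
  have hls4 : ∀ j : ℕ, LevelSmall 4 L j ((ε / 4) / ((L : ℝ) ^ (j + 1)) ^ 2) := hls hε4.le hε4θ
  -- the (8)∃ minimisers of the SMALLER class `sfClass 4 L N (ε/4)`
  obtain ⟨δV', hδV', hint'⟩ := H (ε / 4) hε4 (by linarith) N hN
  refine ⟨min δV' (ε / 4), lt_min hδV' hε4, ?_⟩
  intro V hV k U hU
  obtain ⟨hVu, hVP, hVδ⟩ := hV
  cases k with
  | zero =>
      -- level 0: `U = V`
      have hUV : U = V := eq_of_admissible_zero hU.mem
      rw [hUV]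
      have e : (ε / 4) / ((L : ℝ) ^ 0) ^ 2 = ε / 4 := by simp
      rw [e]
      exact MinimalActionRate.SmallField.mono hVδ (min_le_right _ _)
  | succ j =>
      have hV' : V ∈ {V : Site 4 → Fin 4 → (Matrix n n ℂ)ˣ | IsUnitaryCfg V ∧ IsPeriodicCfg V (N : ℤ) ∧ SmallField V δV'} :=
        ⟨hVu, hVP, MinimalActionRate.SmallField.mono hVδ (min_le_left _ _)⟩
      obtain ⟨Us, hUs, a, ha0, haε, hUsa⟩ := hint' V hV' (j + 1)
      -- `U♯` is admissible in the `ε`-class, interior in its own class, tangent-critical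
      have hmem : Us ∈ admissible (sfClass 4 L N ε) L (j + 1) V := admissible_mono_radius (by linarith) hUs.mem
      have hcrit := tanCritical_of_isMinimiser hL1 hN hUs ha0 haε hUsa (hls4 j)
      have hUsr : SmallField Us ((ε / 4) / ((L : ℝ) ^ (j + 1)) ^ 2) := MinimalActionRate.SmallField.mono hUsa haε.le
      have hM1 : (1 : ℝ) ≤ (L : ℝ) ^ (j + 1) := one_le_pow₀ (by exact_mod_cast hL1)
      -- ALL-SMALL over `𝒯_E` with the class package's slice Poincaré clause, the per-pair REP with the gauge identity from the pair decomposition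
      refine allSmall_of_tanCritical_rep_generic_gauge (d := 4) hL1 hN hε.le hCP0'
        (fun j' W => energyBlockLandauW (d := 4) (n := n) L N (j' + 1) W)
        (fun j' W hW F htan => hT_energyBlockLandau hL1 hε.le hlsε j' W hW F htan)
        (fun j' W hW => slicePoincare_mono (hPE hN hε hεθ₀ j' W hW) (by rw [hCP]; linarith)) hmem hcrit ?_ hUsr U hU.mem (hU.le Us hmem)
      intro U' hU'
      obtain ⟨u, X, XT, XN, α, ν, κ, hu, -, hXs, hXP, hα, hXα, hgauge, hXdec, hXT, -, hXN, hν, hNw, hN1, hαM, hνle, hκle⟩ :=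
        hdec N ε hε hεε₂ hθline V j Us hmem U' hU'
      refine ⟨u, X, XT, XN, α, ν, κ, hu, hXs, hXP, hα, hXα, hgauge, hXdec, hXT, hXN, hν, hNw, hN1, ?_⟩
      -- the per-level strict line from the k-free one
      have hck := kfree_coercivity_card (c := (Fintype.card n : ℝ)) (ε := ε) hcard0 hCP0 hM1 hν hνle hα hαM
      rw [hQ] at hline
      have h2κ : 2 * κ ≤ 2 * (κc * ε) := by linarith
      push_cast at hck hline ⊢
      linarith

end

end Summit.QuantumFields.BalabanUV.T4Continuum.NE7AllMinimisersSmallGeneric
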